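import Literature.NumberTheory.DiophantineGeometry.CatalanCassels
import Literature.NumberTheory.Transcendental.OddZetaPartialFractions
import HarnessLib

/-!
# Cassels' theorem on Catalan's equation, part 2: Runge's method (Schoof, Chapter 6)

Continuation of `CatalanCassels` (Lemma 6.1, Proposition 6.2, the descent lemma). Here the hard
half of [Schoof2009, Theorem 6.4] is proved — for odd primes `p > q` and non-zero integers with
`x ^ p - y ^ q = 1`, `p ∣ y` — by Runge's method as in [Schoof2009, Lemma 6.3 and Theorem 6.4]:
if `p ∤ y` then `x - 1 = a ^ q`, and with `t = a^(-q)`, `m = ⌊p/q⌋ + 1`, `F_m` the degree-`m`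
Taylor polynomial of `(1 + t)^(p/q)` and `D = q^(m + ord_q(m!))`, the number
`D (a^(mq-p) y - a^(mq) F_m(t))` is a non-zero integer (the denominators of the binomial
coefficients `C(p/q, k)` are `q^(k + ord_q(k!))`, Exercise 5.7) of absolute value `< 1`
(the binomial series, Exercises 5.5–5.6, and `|x| ≥ q^(p-1) + q` from Proposition 6.2 (ii)).
Then **Cassels' theorem** `Catalan.cassels` (`q ∣ x` and `p ∣ y`) and
[Schoof2009, Corollary 6.5] follow.

Everything is proved; there are no new definitions.

## References

* R. Schoof, *Catalan's Conjecture*, Universitext, Springer 2009 [Schoof2009], Chapter 5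
  (Exercises 5.5–5.8) and Chapter 6 (Lemma 6.3, Theorem 6.4, Corollary 6.5; book pp. 35–39) —
  held, `lit read book:schoof2009-catalan-s-conjecture` (PDF pp. 116–120).
* J. W. S. Cassels, *On the equation `a^x - b^y = 1`. II*, Proc. Cambridge Philos. Soc. **56**
  (1960), 97–103 [Cassels1960].
-/

namespace Literature.NumberTheory.DiophantineGeometry

namespace Catalan

open Finset

open scoped Nat

/-! ### Binomial coefficients `C(a, n)` of a real number: product formula and a size bound -/

/-- The generalized binomial coefficient of a real number as a product:
`C(a, n) = (∏_{j<n} (a - j)) / n!` (Mathlib's `Ring.choose` on the binomial ring `ℝ`).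
[folklore] -/
theorem ring_choose_eq_prod_div (a : ℝ) (n : ℕ) :
    Ring.choose a n = (∏ j ∈ range n, (a - j)) / n ! := by
  rw [Ring.choose_eq_smul, ← Polynomial.aeval_eq_smeval, Polynomial.aeval_def,
    Polynomial.eval₂_eq_eval_map, descPochhammer_map, descPochhammer_eval_eq_prod_range,
    smul_eq_mul, div_eq_inv_mul]

/-- **[Schoof2009, Exercise 5.6 (a)]**-type bound. If `m - 1 < a < m` then for every `n ≥ m + 1`
the binomial coefficient satisfies `|C(a, n)| ≤ 1/(m + 1)`: indeed
`|a (a-1) ⋯ (a-m+1)| ≤ m!` (with `∏_{j<m} (m - j) = m!` from the tree,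
`OddZeta.prod_range_sub_eq_factorial`), `|a - m| ≤ 1`, and each further factor
`|a - j|/(j + 1) ≤ 1`. [cite: Schoof2009, Exercise 5.6] -/
theorem abs_prod_range_sub_div_factorial_le {a : ℝ} {m : ℕ} (h1 : (m : ℝ) - 1 < a)
    (h2 : a < m) {n : ℕ} (hn : m + 1 ≤ n) :
    |∏ j ∈ range n, (a - j)| / n ! ≤ 1 / (m + 1) := by
  induction n, hn using Nat.le_induction with
  | base =>
    rw [prod_range_succ, abs_mul, Nat.factorial_succ]
    push_cast
    have h0 : ∀ j ∈ range m, 0 ≤ a - j := by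
      intro j hj
      have := mem_range.mp hj
      have : (j : ℝ) ≤ (m : ℝ) - 1 := by
        have : j + 1 ≤ m := this
        have := (Nat.cast_le (α := ℝ)).mpr this
        push_cast at this
        linarith
      linarith
    have hprod : |∏ j ∈ range m, (a - j)| ≤ m ! := by
      rw [abs_of_nonneg (prod_nonneg h0),
        ← Literature.NumberTheory.Transcendental.OddZeta.prod_range_sub_eq_factorial m]
      exact prod_le_prod h0 (fun j hj => by linarith)
    have hlast : |a - m| ≤ 1 := by
      rw [abs_le]
      constructor <;> linarith
    have hm : (0 : ℝ) < m + 1 := by positivity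
    have hfac : (0 : ℝ) < m ! := by positivity
    rw [div_le_div_iff₀ (by positivity) hm]
    calc |∏ j ∈ range m, (a - j)| * |a - m| * (m + 1) ≤ m ! * 1 * (m + 1) := by
          gcongr
      _ = 1 * ((m + 1) * m !) := by ring
  | succ n hn ih =>
    rw [prod_range_succ, abs_mul, Nat.factorial_succ]
    push_cast
    have hfac : (0 : ℝ) < n ! := by positivity
    have hlast : |a - n| ≤ n + 1 := by
      have : (m : ℝ) + 1 ≤ n := by exact_mod_cast hn
      rw [abs_le]
      constructor <;> linarith
    calc |∏ j ∈ range n, (a - j)| * |a - n| / ((n + 1) * n !)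
        = (|∏ j ∈ range n, (a - j)| / n !) * (|a - n| / (n + 1)) := by
          field_simp
      _ ≤ 1 / (m + 1) * 1 := by
          apply mul_le_mul ih _ (by positivity) (by positivity)
          rw [div_le_one (by positivity)]
          exact hlast
      _ = 1 / (m + 1) := mul_one _

/-- **Tail of the binomial series** ([Schoof2009, Exercise 5.8 / Lemma 5.2]-type estimate, from
Mathlib's `Real.one_add_rpow_hasFPowerSeriesOnBall_zero`): if `|C(a, n)| ≤ M` for all
`n ≥ m + 1`, then for `|t| < 1`,
`|(1 + t)^a - ∑_{k ≤ m} C(a, k) t^k| ≤ M |t|^(m+1) / (1 - |t|)`. [cite: Schoof2009, Exercise 5.8] -/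
theorem abs_one_add_rpow_sub_sum_le {a : ℝ} {m : ℕ} {M : ℝ}
    (hM : ∀ n, m + 1 ≤ n → |Ring.choose a n| ≤ M) {t : ℝ} (ht : |t| < 1) :
    |(1 + t) ^ a - ∑ k ∈ range (m + 1), Ring.choose a k * t ^ k| ≤
      M * |t| ^ (m + 1) / (1 - |t|) := by
  have hs : HasSum (fun n => Ring.choose a n * t ^ n) ((1 + t) ^ a) := by
    have h := (Real.one_add_rpow_hasFPowerSeriesOnBall_zero (a := a)).hasSum (y := t) (by
      rw [Metric.mem_eball, edist_zero_right, ← ofReal_norm, ENNReal.ofReal_lt_one,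
        Real.norm_eq_abs]
      exact ht)
    simpa only [binomialSeries, FormalMultilinearSeries.ofScalars_apply_eq, smul_eq_mul,
      zero_add] using h
  have htail := (hasSum_nat_add_iff' (m + 1)).mpr hs
  have hg : HasSum (fun n : ℕ => M * |t| ^ (m + 1) * |t| ^ n) (M * |t| ^ (m + 1) * (1 - |t|)⁻¹) :=
    (hasSum_geometric_of_lt_one (abs_nonneg t) ht).mul_left _
  have hM0 : 0 ≤ M := le_trans (abs_nonneg _) (hM (m + 1) le_rfl)
  have key := HasSum.norm_le_of_bounded htail hg fun n => by
    rw [Real.norm_eq_abs, abs_mul, abs_pow]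
    calc |Ring.choose a (n + (m + 1))| * |t| ^ (n + (m + 1)) ≤ M * |t| ^ (n + (m + 1)) :=
          mul_le_mul_of_nonneg_right (hM _ (by omega)) (pow_nonneg (abs_nonneg t) _)
      _ = M * |t| ^ (m + 1) * |t| ^ n := by ring
  rw [Real.norm_eq_abs] at key
  rwa [div_eq_mul_inv]

/-! ### Exercise 5.7: the denominators of `C(p/q, k)` are powers of `q` -/

/-- **[Schoof2009, Exercise 5.7]** (integrality of `C(p/q, k)` away from `q`). For a prime `q`
not dividing `p` and `k ≥ 0`, write `k! = q^e K` with `e = ord_q(k!)`. Then `K` divides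
`N_k = ∏_{j<k} (p - j q)` — so `C(p/q, k) = N_k/(q^k k!) = u/q^(k + e)` with `u = N_k/K ∈ ℤ` —
and `q ∤ u`. Proof: `q` is invertible modulo `K`; choosing `r ≡ p/q (mod K)`, `r ≥ k`, one has
`N_k ≡ q^k r (r-1) ⋯ (r-k+1) ≡ 0 (mod K)` because `k!` divides a product of `k` consecutive
integers; and `q ∤ N_k` since every factor is `≡ p (mod q)`. [cite: Schoof2009, Exercise 5.7] -/
theorem exists_choose_num {p q : ℕ} (hq : q.Prime) (hqp : ¬ q ∣ p) (k : ℕ) :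
    ∃ u : ℤ, ¬ (q : ℤ) ∣ u ∧
      (k ! : ℤ) * u = (q : ℤ) ^ (padicValNat q k !) * ∏ j ∈ range k, ((p : ℤ) - j * q) := by
  haveI := Fact.mk hq
  set e := padicValNat q k ! with he
  set Nk := ∏ j ∈ range k, ((p : ℤ) - j * q) with hNk
  have hq' : Prime (q : ℤ) := Nat.prime_iff_prime_int.mp hq
  -- `k! = q^e K` with `q ∤ K`
  obtain ⟨K, hK⟩ : q ^ e ∣ k ! := pow_padicValNat_dvd
  have hqK : ¬ q ∣ K := by
    intro hd
    have : q ^ (e + 1) ∣ k ! := by rw [hK, pow_succ]; exact mul_dvd_mul_left _ hd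
    exact pow_succ_padicValNat_not_dvd (Nat.factorial_ne_zero k) this
  have hK0 : K ≠ 0 := by
    rintro rfl
    exact Nat.factorial_ne_zero k (by simpa using hK)
  -- `q ∤ N_k`
  have hqN : ¬ (q : ℤ) ∣ Nk := by
    rw [hNk]
    intro hd
    obtain ⟨j, -, hj⟩ := (Prime.dvd_finsetProd_iff hq' _).mp hd
    have : (q : ℤ) ∣ (p : ℤ) := by
      have h2 : (q : ℤ) ∣ (p : ℤ) - j * q + j * q := dvd_add hj (dvd_mul_left _ _)
      rwa [sub_add_cancel] at h2
    exact hqp (Int.natCast_dvd_natCast.mp this)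
  -- `r ≡ p/q (mod K)` with `r ≥ k`: from `c q + d K = 1` take `r = c p + K (|c| p + k)`
  have hcop : IsCoprime (q : ℤ) (K : ℤ) :=
    Nat.isCoprime_iff_coprime.mpr ((Nat.Prime.coprime_iff_not_dvd hq).mpr hqK)
  obtain ⟨c, d, hcd⟩ := hcop
  have hK1 : (1 : ℤ) ≤ K := by exact_mod_cast Nat.one_le_iff_ne_zero.mpr hK0
  obtain ⟨r, hrk, hKr⟩ : ∃ r : ℕ, k ≤ r ∧ (K : ℤ) ∣ q * r - p := by
    set R : ℤ := c * p + K * (|c| * p + k) with hR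
    have hR0 : (k : ℤ) ≤ R := by
      have hc : -(|c| * (p : ℤ)) ≤ c * p := by
        have := neg_abs_le (c * (p : ℤ))
        rwa [abs_mul, Nat.abs_cast] at this
      have hcp : 0 ≤ |c| * (p : ℤ) := by positivity
      rw [hR]
      nlinarith
    refine ⟨R.toNat, by omega, ?_⟩
    rw [Int.toNat_of_nonneg (by omega), hR]
    exact ⟨q * (|c| * p + k) - d * p, by linear_combination (p : ℤ) * hcd⟩
  -- `K ∣ N_k`: modulo `K`, `N_k ≡ q^k · r (r-1) ⋯ (r-k+1)`, a multiple of `k!`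
  haveI : NeZero K := ⟨hK0⟩
  have hKN : (K : ℤ) ∣ Nk := by
    rw [← ZMod.intCast_zmod_eq_zero_iff_dvd, hNk, Int.cast_prod]
    have hpr : ((p : ℤ) : ZMod K) = (q : ℤ) * (r : ℤ) := by
      have := (ZMod.intCast_zmod_eq_zero_iff_dvd _ K).mpr hKr
      push_cast at this ⊢
      linear_combination -this
    have hterm : ∀ j ∈ range k, (((p : ℤ) - j * q : ℤ) : ZMod K) =
        ((q : ℤ) : ZMod K) * (((r - j : ℕ) : ℤ) : ZMod K) := by
      intro j hj
      have hjr : j ≤ r := (mem_range.mp hj).le.trans hrk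
      push_cast [hjr]
      rw [show ((p : ℕ) : ZMod K) = ((p : ℤ) : ZMod K) by norm_cast, hpr]
      push_cast
      ring
    rw [prod_congr rfl hterm, prod_mul_distrib, prod_const, card_range]
    have hdesc : ∏ j ∈ range k, (((r - j : ℕ) : ℤ) : ZMod K) = ((r.descFactorial k : ℕ) : ZMod K) := by
      rw [Nat.descFactorial_eq_prod_range]
      push_cast
      rfl
    rw [hdesc]
    have : ((r.descFactorial k : ℕ) : ZMod K) = 0 := by
      rw [ZMod.natCast_eq_zero_iff]
      exact (Dvd.intro_left _ hK.symm).trans (Nat.factorial_dvd_descFactorial r k)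
    rw [this, mul_zero]
  obtain ⟨u, hu⟩ := hKN
  refine ⟨u, fun hqu => hqN (hu ▸ dvd_mul_of_dvd_right hqu _), ?_⟩
  rw [hu, hK]
  push_cast
  ring

/-! ### Lemma 6.3: the Runge estimate for `F(t) = ((1 + t)^p - t^p)^(1/q)` at `t = a^(-q)` -/

/-- **[Schoof2009, Lemma 6.3]** in the form needed for Theorem 6.4. Let `q` be odd, `m` an
integer with `m - 1 < p/q < m`, `a` an integer with `N = |a|^q ≥ 2p` (and `≥ 3`), and `y` an
integer with `y ^ q = (a ^ q + 1) ^ p - 1`, so that `F = y/a^p` is the real `q`-th root of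
`(1 + t)^p - t^p`, `t = a^(-q)`. Then, with `F_m(t) = ∑_{k ≤ m} C(p/q, k) t^k`,
`|F - F_m(t)| ≤ 2/N^p + 1/((m + 1) N^m (N - 1))`: indeed `|F - (1+t)^(p/q)| ≤ |t|^p / B^(q-1)`
with `B^(q-1) = (1+t)^(p - p/q) ≥ 1 + p t ≥ 1/2` (Bernoulli), and
`|(1+t)^(p/q) - F_m(t)| ≤ |t|^(m+1)/((m+1)(1 - |t|))` by the binomial series and
`|C(p/q, k)| ≤ 1/(m+1)` for `k > m`. [cite: Schoof2009, Lemma 6.3] -/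
theorem runge_estimate {p q m : ℕ} (hqo : Odd q) (hm1 : (m : ℝ) - 1 < p / q) (hm2 : (p : ℝ) / q < m)
    {a y : ℤ} (hN3 : (3 : ℝ) ≤ |(a : ℝ)| ^ q) (hN2p : 2 * (p : ℝ) ≤ |(a : ℝ)| ^ q)
    (hy : y ^ q = (a ^ q + 1) ^ p - 1) :
    |(y : ℝ) / (a : ℝ) ^ p -
        ∑ k ∈ range (m + 1), Ring.choose ((p : ℝ) / q) k * (((a : ℝ) ^ q)⁻¹) ^ k| ≤
      2 / (|(a : ℝ)| ^ q) ^ p + 1 / ((m + 1) * (|(a : ℝ)| ^ q) ^ m * (|(a : ℝ)| ^ q - 1)) := by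
  have hq0 : q ≠ 0 := fun h0 => by simp [h0] at hqo
  have hq0' : (q : ℝ) ≠ 0 := by exact_mod_cast hq0
  have hp0 : p ≠ 0 := by
    rintro rfl
    simp only [Nat.cast_zero, zero_div] at hm1 hm2
    have h1 : (m : ℝ) < 1 := by linarith
    norm_cast at h1 hm2
    omega
  set N : ℝ := |(a : ℝ)| ^ q with hN
  set t : ℝ := ((a : ℝ) ^ q)⁻¹ with ht
  set α : ℝ := (p : ℝ) / q with hα
  set F : ℝ := (y : ℝ) / (a : ℝ) ^ p with hF
  have ha : (a : ℝ) ≠ 0 := by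
    rintro h0
    rw [h0, abs_zero, zero_pow hq0] at hN
    linarith
  have hN0 : 0 < N := by linarith
  have htN : |t| = N⁻¹ := by rw [ht, abs_inv, abs_pow]
  have ht3 : |t| ≤ 1 / 3 := by
    rw [htN, inv_eq_one_div]
    exact one_div_le_one_div_of_le (by norm_num) hN3
  have ht1 : |t| < 1 := by linarith
  have h1t : 0 < 1 + t := by linarith [neg_abs_le t]
  -- `F ^ q = (1 + t) ^ p - t ^ p`, `F > 0`
  have hyq : (y : ℝ) ^ q = ((a : ℝ) ^ q + 1) ^ p - 1 := by exact_mod_cast hy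
  have haq : (a : ℝ) ^ q ≠ 0 := pow_ne_zero _ ha
  have hFq : F ^ q = (1 + t) ^ p - t ^ p := by
    have e1 : (1 + t) = ((a : ℝ) ^ q + 1) / (a : ℝ) ^ q := by rw [ht]; field_simp
    rw [e1, hF, ht, div_pow, div_pow, inv_pow, ← pow_mul, mul_comm p q, pow_mul, hyq]
    field_simp
  have hFpos : 0 < F := by
    rw [← hqo.pow_pos_iff, hFq, sub_pos]
    calc t ^ p ≤ |t| ^ p := by rw [← abs_pow]; exact le_abs_self _
      _ < (1 + t) ^ p := by
          apply pow_lt_pow_left₀ _ (abs_nonneg t) hp0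
          linarith [neg_abs_le t, le_abs_self t]
  -- `B = (1 + t) ^ (p/q)`, `B ^ q = (1 + t) ^ p`, `B ^ (q - 1) ≥ 1/2`
  set B : ℝ := (1 + t) ^ α with hB
  have hBpos : 0 < B := Real.rpow_pos_of_pos h1t α
  have hBq : B ^ q = (1 + t) ^ p := by
    rw [hB, ← Real.rpow_natCast, ← Real.rpow_mul h1t.le, hα, div_mul_cancel₀ _ hq0',
      Real.rpow_natCast]
  have hBq1 : 1 / 2 ≤ B ^ (q - 1) := by
    by_cases ht0 : 0 ≤ t
    · have h1 : 1 ≤ B := Real.one_le_rpow (by linarith) (by positivity)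
      linarith [one_le_pow₀ (n := q - 1) h1]
    · push Not at ht0
      have hexp : α * ((q - 1 : ℕ) : ℝ) ≤ p := by
        rw [hα, Nat.cast_sub (Nat.pos_of_ne_zero hq0), Nat.cast_one, div_mul_eq_mul_div,
          div_le_iff₀ (by positivity)]
        nlinarith [(Nat.cast_pos (α := ℝ)).mpr (Nat.pos_of_ne_zero hp0)]
      have h2 : (1 + t) ^ (p : ℝ) ≤ B ^ (q - 1) := by
        rw [hB, ← Real.rpow_mul_natCast h1t.le]
        exact Real.rpow_le_rpow_of_exponent_ge h1t (by linarith) hexp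
      rw [Real.rpow_natCast] at h2
      have h3 : 1 + (p : ℝ) * t ≤ (1 + t) ^ p := one_add_mul_le_pow (by linarith) p
      have h4 : (1 : ℝ) / 2 ≤ 1 + p * t := by
        have : (p : ℝ) * |t| ≤ 1 / 2 := by
          rw [htN]
          rw [hN] at hN2p hN0
          rw [← div_eq_mul_inv, div_le_iff₀ hN0]
          linarith
        rw [abs_of_neg ht0] at this
        linarith
      linarith
  -- `|F - B| ≤ 2 |t| ^ p`
  have hFB : |F - B| ≤ 2 * |t| ^ p := by
    set G := ∑ i ∈ range q, F ^ i * B ^ (q - 1 - i) with hG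
    have hGFB : G * (F - B) = F ^ q - B ^ q := geom_sum₂_mul F B q
    have hGge : B ^ (q - 1) ≤ G := by
      have := single_le_sum (f := fun i => F ^ i * B ^ (q - 1 - i)) (fun i _ => by positivity)
        (mem_range.mpr (Nat.pos_of_ne_zero hq0))
      simpa using this
    have hGpos : 0 < G := by linarith
    have hdiff : F - B = -t ^ p / G := by
      rw [eq_div_iff hGpos.ne', mul_comm, hGFB, hFq, hBq]
      ring
    rw [hdiff, abs_div, abs_neg, abs_pow, abs_of_pos hGpos]
    calc |t| ^ p / G ≤ |t| ^ p / (1 / 2) :=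
          div_le_div_of_nonneg_left (by positivity) (by norm_num) (by linarith)
      _ = 2 * |t| ^ p := by ring
  -- `|B - F_m| ≤ |t|^(m+1) / ((m+1)(1 - |t|))`
  have hC : ∀ n, m + 1 ≤ n → |Ring.choose α n| ≤ 1 / (m + 1) := fun n hn => by
    rw [ring_choose_eq_prod_div, abs_div, Nat.abs_cast]
    exact abs_prod_range_sub_div_factorial_le hm1 hm2 hn
  have hBF := abs_one_add_rpow_sub_sum_le hC ht1
  -- combine
  have hFF : |F - ∑ k ∈ range (m + 1), Ring.choose α k * t ^ k| ≤
      2 * |t| ^ p + 1 / (m + 1) * |t| ^ (m + 1) / (1 - |t|) :=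
    calc |F - ∑ k ∈ range (m + 1), Ring.choose α k * t ^ k|
        ≤ |F - B| + |B - ∑ k ∈ range (m + 1), Ring.choose α k * t ^ k| := abs_sub_le _ _ _
      _ ≤ 2 * |t| ^ p + 1 / (m + 1) * |t| ^ (m + 1) / (1 - |t|) := add_le_add hFB hBF
  have hN1 : N - 1 ≠ 0 := by linarith
  calc |F - ∑ k ∈ range (m + 1), Ring.choose α k * t ^ k|
      ≤ 2 * |t| ^ p + 1 / (m + 1) * |t| ^ (m + 1) / (1 - |t|) := hFF
    _ = 2 / N ^ p + 1 / ((m + 1) * N ^ m * (N - 1)) := by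
        rw [htN]
        simp only [inv_pow]
        rw [pow_succ]
        have hN0' : N ≠ 0 := hN0.ne'
        have hNm : N ^ m ≠ 0 := pow_ne_zero _ hN0'
        have hNp : N ^ p ≠ 0 := pow_ne_zero _ hN0'
        field_simp

/-- `2 (n + 3) ≤ 3 ^ (n + 2)`, i.e. `2 p ≤ 3 ^ (p - 1)` for `p ≥ 3`. [folklore] -/
theorem two_mul_le_three_pow (n : ℕ) : 2 * (n + 3) ≤ 3 ^ (n + 2) := by
  induction n with
  | zero => norm_num
  | succ n ih => rw [pow_succ]; omega

/-! ### Theorem 6.4: the larger exponent divides `y` -/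

/-- **[Schoof2009, Exercise 5.5 (b)]** as used on p. 38: for odd primes `p > q` (here: `q ≥ 3`,
`p ≥ 5`, `q ∤ p`) and `m = ⌊p/q⌋ + 1` one has `m + ord_q(m!) ≤ p - 2`, because
`(q - 1) ord_q(m!) ≤ m - 1` (Legendre) and `q m ≤ p + q - 1`. [cite: Schoof2009, Exercise 5.5] -/
theorem div_succ_add_padicValNat_factorial_le {p q : ℕ} (hq : q.Prime) (hq3 : 3 ≤ q)
    (hp5 : 5 ≤ p) (hqp : ¬ q ∣ p) :
    p / q + 1 + padicValNat q (p / q + 1)! ≤ p - 2 := by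
  haveI := Fact.mk hq
  set m := p / q + 1 with hm
  have hdiv := Nat.div_add_mod p q
  have hmod : 0 < p % q := Nat.pos_of_ne_zero fun h0 => hqp (Nat.dvd_of_mod_eq_zero h0)
  have h1 : (q - 1) * padicValNat q m ! < m :=
    sub_one_mul_padicValNat_factorial_lt_of_ne_zero q (Nat.succ_ne_zero _)
  have h2 : q * m ≤ p + q - 1 := by
    rw [hm, mul_add, mul_one]
    omega
  have key : (q - 1) * (m + padicValNat q m !) ≤ (q - 1) * (p - 2) := by
    zify [(by omega : 1 ≤ q), (by omega : 2 ≤ p)] at h1 h2 ⊢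
    nlinarith [mul_nonneg (by linarith : (0 : ℤ) ≤ (q : ℤ) - 3)
      (by linarith : (0 : ℤ) ≤ (p : ℤ) - 5)]
  exact Nat.le_of_mul_le_mul_left key (by omega)

/-- From the integrality datum of `exists_choose_num` to the value of the binomial coefficient:
if `k! u = q^e ∏_{j<k} (p - j q)` then `C(p/q, k) = u / q^(k + e)` in `ℝ`.
[cite: Schoof2009, Exercise 5.7] -/
theorem ring_choose_div_eq {p q : ℕ} (hq0 : q ≠ 0) {k e : ℕ} {u : ℤ}
    (h : (k ! : ℤ) * u = (q : ℤ) ^ e * ∏ j ∈ range k, ((p : ℤ) - j * q)) :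
    Ring.choose ((p : ℝ) / q) k = (u : ℝ) / (q : ℝ) ^ (k + e) := by
  have hq0' : (q : ℝ) ≠ 0 := by exact_mod_cast hq0
  have h2 := congrArg (Int.cast : ℤ → ℝ) h
  push_cast at h2
  have hprod : ∏ j ∈ range k, ((p : ℝ) / q - j) =
      (∏ j ∈ range k, ((p : ℝ) - j * q)) / (q : ℝ) ^ k := by
    rw [← card_range k, ← prod_const, card_range, ← prod_div_distrib]
    refine prod_congr rfl fun j _ => ?_
    field_simp
  rw [ring_choose_eq_prod_div, hprod, div_div, pow_add,
    div_eq_div_iff (by positivity) (by positivity)]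
  linear_combination -((q : ℝ) ^ k) * h2

/-- The final numerical inequality of the proof of [Schoof2009, Theorem 6.4] in the present
bookkeeping: with `D = q^(m + ord_q(m!))`, `N = |a|^q`, `3 D ≤ N - 2`, `N ≥ 3`, `p - m ≥ 2` and
`m + 1 ≥ 3`, `D N^m (2/N^p + 1/((m+1) N^m (N-1))) < 1`. [cite: Schoof2009, Theorem 6.4 (proof)] -/
theorem runge_final_lt_one {D N : ℝ} {m p : ℕ} (hD0 : 0 < D) (hN3 : 3 ≤ N)
    (hDle : 3 * D ≤ N - 2) (hpm : 2 ≤ p - m) (hmp : m ≤ p) (hm3 : (3 : ℝ) ≤ m + 1) :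
    D * N ^ m * (2 / N ^ p + 1 / ((m + 1) * N ^ m * (N - 1))) < 1 := by
  have hN0 : 0 < N := by linarith
  have hN1 : 0 < N - 1 := by linarith
  have hNpm : N ^ 2 ≤ N ^ (p - m) := pow_le_pow_right₀ (by linarith) hpm
  have hNp : N ^ p = N ^ m * N ^ (p - m) := by rw [← pow_add, Nat.add_sub_cancel' hmp]
  calc D * N ^ m * (2 / N ^ p + 1 / ((m + 1) * N ^ m * (N - 1)))
      = 2 * D / N ^ (p - m) + D / ((m + 1) * (N - 1)) := by
        rw [hNp]
        field_simp
    _ ≤ 2 * D / N ^ 2 + D / (3 * (N - 1)) := by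
        gcongr
    _ < 1 := by
        rw [div_add_div _ _ (by positivity) (by positivity), div_lt_one (by positivity)]
        nlinarith [mul_le_mul_of_nonneg_right hDle (sq_nonneg N),
          mul_le_mul_of_nonneg_right hDle hN1.le]


set_option maxHeartbeats 800000 in
/-- **[Schoof2009, Theorem 6.4], the hard half** (Runge's method). Let `p > q` be odd primes and
`x, y` non-zero integers with `x ^ p - y ^ q = 1`. Then `p ∣ y`. Sketch (Schoof, pp. 36–38):
if not, `x - 1` and `(x^p - 1)/(x - 1)` are coprime, so `x - 1 = a ^ q` with `|a| ≥ 2`; put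
`t = a^(-q)`, `m = ⌊p/q⌋ + 1`, `D = q^(m + ord_q(m!))`; then
`Z = D (a^(mq-p) y - ∑_{k ≤ m} C(p/q, k) a^(q(m-k)))` is an integer (Exercise 5.7) with
`Z ≡ -u_m ≢ 0 (mod q)`, while `|Z| = D |a|^(mq) |F(t) - F_m(t)| < 1` by Lemma 6.3,
`|a|^q ≥ q^(p-1) + q - 1` (Proposition 6.2 (ii)) and `m + ord_q(m!) ≤ p - 2` (Exercise 5.5).
[cite: Schoof2009, Theorem 6.4] -/
theorem dvd_of_pow_sub_pow_eq_one' {p q : ℕ} (hp : p.Prime) (hq : q.Prime) (hpo : Odd p)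
    (hqo : Odd q) (hqp : q < p) {x y : ℤ} (hx : x ≠ 0) (hy : y ≠ 0) (h : x ^ p - y ^ q = 1) :
    (p : ℤ) ∣ y := by
  by_contra hpy
  have hp' : Prime (p : ℤ) := Nat.prime_iff_prime_int.mp hp
  have hq3 : 3 ≤ q := by
    have := hq.two_le
    obtain ⟨k, hk⟩ := hqo
    omega
  have hp5 : 5 ≤ p := by
    obtain ⟨k, hk⟩ := hpo
    obtain ⟨j, hj⟩ := hqo
    omega
  -- Step A: `x - 1 = a ^ q`
  set S := ∑ i ∈ range p, x ^ i * 1 ^ (p - 1 - i) with hS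
  have hSx : S * (x - 1) = y ^ q := by rw [geom_sum₂_mul, one_pow]; linarith
  have hx1 : x - 1 ≠ 0 := by
    intro h0
    rw [h0, mul_zero] at hSx
    exact hy (pow_eq_zero_iff hq.ne_zero |>.mp hSx.symm)
  have hcop : IsCoprime (x - 1) S := by
    refine isCoprime_of_prime_dvd (fun ⟨h0, _⟩ => hx1 h0) fun r hr hr1 hr2 => ?_
    have hr3 : r ∣ (p : ℤ) * 1 ^ (p - 1) := (dvd_geom_sum₂_iff_of_dvd_sub hr1).mp hr2
    rw [one_pow, mul_one] at hr3
    have hassoc : Associated r (p : ℤ) := (hr.dvd_prime_iff_associated hp').mp hr3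
    have hpS : (p : ℤ) ∣ S := hassoc.dvd_iff_dvd_left.mp hr2
    have : (p : ℤ) ∣ y ^ q := hSx ▸ dvd_mul_of_dvd_left hpS _
    exact hpy (hp'.dvd_of_dvd_pow this)
  obtain ⟨a, ha⟩ := Int.eq_pow_of_mul_eq_pow_odd_left hcop hqo (by rw [mul_comm]; exact hSx)
  -- Step B: size of `a`
  have hqx : (q : ℤ) ∣ x := dvd_of_pow_sub_pow_eq_one hp hq hpo hqo hqp hx hy h
  have habs : (q : ℤ) + (q : ℤ) ^ (p - 1) ≤ |x| :=
    abs_ge_of_pow_sub_pow_eq_one hp hq hpo hqo hqp hx hy h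
  have haq : (q : ℤ) ^ (p - 1) + 2 ≤ |a| ^ q := by
    have h1 : |x| ≤ |a| ^ q + 1 := by
      calc |x| = |a ^ q + 1| := by rw [← ha]; ring_nf
        _ ≤ |a ^ q| + |1| := abs_add_le _ _
        _ = |a| ^ q + 1 := by rw [abs_pow, abs_one]
    have : (3 : ℤ) ≤ q := by exact_mod_cast hq3
    linarith
  have hyq : y ^ q = (a ^ q + 1) ^ p - 1 := by rw [← ha, sub_add_cancel]; linarith
  have ha0 : a ≠ 0 := by
    rintro rfl
    rw [zero_pow hq.ne_zero] at ha
    exact hx1 ha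
  -- Step C: the exponent `m = ⌊p/q⌋ + 1` and Legendre
  haveI := Fact.mk hq
  have hqnp : ¬ q ∣ p := fun hd =>
    absurd ((Nat.prime_dvd_prime_iff_eq hq hp).mp hd) hqp.ne
  set m := p / q + 1 with hm
  have hm0 : m ≠ 0 := by rw [hm]; exact Nat.succ_ne_zero _
  have hdiv := Nat.div_add_mod p q
  have hmod : 0 < p % q := Nat.pos_of_ne_zero fun h0 => hqnp (Nat.dvd_of_mod_eq_zero h0)
  have hmodlt : p % q < q := Nat.mod_lt _ hq.pos
  have hm1 : (m : ℝ) - 1 < p / q := by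
    rw [lt_div_iff₀ (by exact_mod_cast hq.pos), hm]
    push_cast
    have : ((q * (p / q) : ℕ) : ℝ) + 1 ≤ p := by
      exact_mod_cast (by omega : q * (p / q) + 1 ≤ p)
    push_cast at this
    nlinarith
  have hm2 : (p : ℝ) / q < m := by
    rw [div_lt_iff₀ (by exact_mod_cast hq.pos), hm]
    push_cast
    have : (p : ℝ) < ((q * (p / q) : ℕ) : ℝ) + q := by
      exact_mod_cast (by omega : p < q * (p / q) + q)
    push_cast at this
    nlinarith
  have hmp : m + 2 ≤ p := by
    have h1 : p / q ≤ p / 3 := Nat.div_le_div_left hq3 (by norm_num)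
    have h2 := Nat.mul_div_le p 3
    omega
  have hpmq : p ≤ m * q := by
    have : p < q * (p / q) + q := by omega
    rw [hm]
    nlinarith
  have hE : m + padicValNat q m ! ≤ p - 2 := div_succ_add_padicValNat_factorial_le hq hq3 hp5 hqnp
  have hemono : ∀ k, k ≤ m → padicValNat q k ! ≤ padicValNat q m ! := fun k hk =>
    (padicValNat_dvd_iff_le (Nat.factorial_ne_zero m)).mp
      (pow_padicValNat_dvd.trans (Nat.factorial_dvd_factorial hk))
  -- Step D: the integers `u k` with `C(p/q, k) = u k / q^(k + ord_q(k!))`, and `Z`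
  choose u hu using fun k => exists_choose_num (p := p) hq hqnp k
  set E : ℕ := m + padicValNat q m ! with hEdef
  set T : ℕ → ℤ := fun k =>
    (q : ℤ) ^ (E - (k + padicValNat q k !)) * u k * a ^ (q * (m - k)) with hT
  set Z : ℤ := (q : ℤ) ^ E * a ^ (m * q - p) * y - ∑ k ∈ range (m + 1), T k with hZ
  have hq' : Prime (q : ℤ) := Nat.prime_iff_prime_int.mp hq
  have hTm : T m = u m := by
    simp only [hT, hEdef, Nat.sub_self, pow_zero, one_mul, mul_zero, mul_one]
  have hZq : ¬ (q : ℤ) ∣ Z := by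
    intro hqZ
    have hZu : Z + u m = (q : ℤ) ^ E * a ^ (m * q - p) * y - ∑ k ∈ range m, T k := by
      rw [hZ, sum_range_succ, hTm]
      ring
    have hdvd : (q : ℤ) ∣ Z + u m := by
      rw [hZu]
      refine dvd_sub (dvd_mul_of_dvd_left (dvd_mul_of_dvd_left (dvd_pow_self _ ?_) _) _)
        (dvd_sum fun k hk => ?_)
      · rw [hEdef]
        exact (Nat.add_pos_left (Nat.pos_of_ne_zero hm0) _).ne'
      · have hkm : k < m := mem_range.mp hk
        have hle := hemono k hkm.le
        refine dvd_mul_of_dvd_left (dvd_mul_of_dvd_left (dvd_pow_self _ ?_) _) _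
        rw [hEdef]
        exact Nat.sub_ne_zero_of_lt (by omega)
    have := dvd_sub hdvd hqZ
    rw [add_sub_cancel_left] at this
    exact (hu m).1 this
  have hZ0 : Z ≠ 0 := fun h0 => hZq (h0 ▸ dvd_zero _)
  have hZ1 : (1 : ℝ) ≤ |(Z : ℝ)| := by exact_mod_cast Int.one_le_abs hZ0
  -- Step E: `Z` as a real number: `Z = q^E a^(mq) (F - F_m(t))`
  have hq0' : (q : ℝ) ≠ 0 := by exact_mod_cast hq.ne_zero
  have ha' : (a : ℝ) ≠ 0 := by exact_mod_cast ha0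
  set α : ℝ := (p : ℝ) / q with hα
  set t : ℝ := ((a : ℝ) ^ q)⁻¹ with ht
  have hCk : ∀ k, Ring.choose α k = (u k : ℝ) / (q : ℝ) ^ (k + padicValNat q k !) := fun k =>
    ring_choose_div_eq hq.ne_zero (hu k).2
  have hZR : (Z : ℝ) = (q : ℝ) ^ E * (a : ℝ) ^ (m * q) *
      ((y : ℝ) / (a : ℝ) ^ p - ∑ k ∈ range (m + 1), Ring.choose α k * t ^ k) := by
    rw [hZ, mul_sub, mul_sum]
    push_cast
    congr 1
    · rw [← pow_sub_mul_pow (a : ℝ) hpmq]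
      field_simp
    · refine sum_congr rfl fun k hk => ?_
      have hkm : k ≤ m := Nat.lt_succ_iff.mp (mem_range.mp hk)
      have hle : k + padicValNat q k ! ≤ E := add_le_add hkm (hemono k hkm)
      have hexp : (a : ℝ) ^ (m * q) = (a : ℝ) ^ (q * (m - k)) * ((a : ℝ) ^ q) ^ k := by
        rw [← pow_mul, ← pow_add, ← mul_add, Nat.sub_add_cancel hkm, mul_comm]
      rw [hT, hCk k, ← pow_sub_mul_pow (q : ℝ) hle, ht, inv_pow, hexp]
      push_cast
      field_simp
  -- Step F: the estimate `|Z| < 1`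
  set N : ℝ := |(a : ℝ)| ^ q with hN
  have hNq : (q : ℝ) ^ (p - 1) + 2 ≤ N := by
    have hcast : (((q : ℤ) ^ (p - 1) + 2 : ℤ) : ℝ) ≤ ((|a| ^ q : ℤ) : ℝ) := by exact_mod_cast haq
    push_cast at hcast
    rwa [hN]
  have hq3' : (3 : ℝ) ≤ q := by exact_mod_cast hq3
  have hqpow : (1 : ℝ) ≤ (q : ℝ) ^ (p - 1) := one_le_pow₀ (by linarith)
  have hN3 : (3 : ℝ) ≤ N := by linarith
  have hN2p : 2 * (p : ℝ) ≤ N := by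
    have h3p : 2 * (p : ℝ) ≤ (3 : ℝ) ^ (p - 1) := by
      have := two_mul_le_three_pow (p - 3)
      rw [show p - 3 + 3 = p by omega, show p - 3 + 2 = p - 1 by omega] at this
      exact_mod_cast this
    have h3q : (3 : ℝ) ^ (p - 1) ≤ (q : ℝ) ^ (p - 1) := pow_le_pow_left₀ (by norm_num) hq3' _
    linarith
  have hR := runge_estimate (m := m) hqo hm1 hm2 hN3 hN2p hyq
  have hZabs : |(Z : ℝ)| = (q : ℝ) ^ E * N ^ m *
      |(y : ℝ) / (a : ℝ) ^ p - ∑ k ∈ range (m + 1), Ring.choose α k * t ^ k| := by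
    rw [hZR, abs_mul, abs_mul, abs_pow, abs_pow, Nat.abs_cast, hN, ← pow_mul, mul_comm q m]
  -- `D = q^E ≤ q^(p-2)`, so `3 D ≤ q D ≤ q^(p-1) ≤ N - 2`
  set D : ℝ := (q : ℝ) ^ E with hD
  have hD0 : 0 < D := by positivity
  have hDle : 3 * D ≤ N - 2 := by
    have h1 : D ≤ (q : ℝ) ^ (p - 2) := pow_le_pow_right₀ (by linarith) hE
    have h2 : (q : ℝ) * (q : ℝ) ^ (p - 2) = (q : ℝ) ^ (p - 1) := by
      rw [← pow_succ', show p - 2 + 1 = p - 1 by omega]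
    nlinarith
  have hm3 : (3 : ℝ) ≤ (m : ℝ) + 1 := by
    have : 2 ≤ m := by rw [hm]; have := Nat.div_pos hqp.le hq.pos; omega
    exact_mod_cast Nat.succ_le_succ this
  have hfinal : D * N ^ m * (2 / N ^ p + 1 / ((m + 1) * N ^ m * (N - 1))) < 1 :=
    runge_final_lt_one hD0 hN3 hDle (by omega) (by omega) hm3
  have : |(Z : ℝ)| < 1 := by
    rw [hZabs]
    calc (q : ℝ) ^ E * N ^ m * |(y : ℝ) / (a : ℝ) ^ p - ∑ k ∈ range (m + 1), Ring.choose α k * t ^ k|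
        ≤ (q : ℝ) ^ E * N ^ m * (2 / N ^ p + 1 / ((m + 1) * N ^ m * (N - 1))) :=
          mul_le_mul_of_nonneg_left hR (by positivity)
      _ < 1 := hfinal
  linarith

/-- **Cassels' theorem** [Schoof2009, Theorem 6.4] (J. W. S. Cassels, 1960). Let `p, q` be odd
primes and `x, y` non-zero integers with `x ^ p - y ^ q = 1`. Then `q ∣ x` and `p ∣ y`.
(By Lemma 6.1, `p ≠ q`; for `p > q` this is Proposition 6.2 (i) and the Runge argument
`dvd_of_pow_sub_pow_eq_one'`; for `p < q` apply that case to `(-y) ^ q - (-x) ^ p = 1`.)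
[cite: Schoof2009, Theorem 6.4] [cite: Cassels1960] -/
theorem cassels {p q : ℕ} (hp : p.Prime) (hq : q.Prime) (hpo : Odd p) (hqo : Odd q) {x y : ℤ}
    (hx : x ≠ 0) (hy : y ≠ 0) (h : x ^ p - y ^ q = 1) : (q : ℤ) ∣ x ∧ (p : ℤ) ∣ y := by
  rcases lt_trichotomy q p with hqp | rfl | hpq
  · exact ⟨dvd_of_pow_sub_pow_eq_one hp hq hpo hqo hqp hx hy h,
      dvd_of_pow_sub_pow_eq_one' hp hq hpo hqo hqp hx hy h⟩
  · have hq3 : 3 ≤ q := by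
      have := hq.two_le
      obtain ⟨k, hk⟩ := hqo
      omega
    exact absurd h (pow_sub_pow_ne_one hqo hq3 hx hy)
  · have h' : (-y) ^ q - (-x) ^ p = 1 := by rw [hqo.neg_pow, hpo.neg_pow]; linarith
    have h1 := dvd_of_pow_sub_pow_eq_one hq hp hqo hpo hpq (neg_ne_zero.mpr hy)
      (neg_ne_zero.mpr hx) h'
    have h2 := dvd_of_pow_sub_pow_eq_one' hq hp hqo hpo hpq (neg_ne_zero.mpr hy)
      (neg_ne_zero.mpr hx) h'
    exact ⟨(dvd_neg).mp h2, (dvd_neg).mp h1⟩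

/-! ### Corollary 6.5: the `p`-adic, `q`-adic and Archimedean shape of a solution -/

/-- **[Schoof2009, Corollary 6.5 (i)]** (`p`-adic information). For odd primes `p, q` and
non-zero integers with `x ^ p - y ^ q = 1` there are integers `a, v` with
`x - 1 = p ^ (q-1) a ^ q`, `(x ^ p - 1)/(x - 1) = p v ^ q` and `y = p a v`; moreover `p ∤ v` and
`v > 0`. (Cassels' theorem gives `p ∣ y`; then the descent lemma `Catalan.descent`.)
[cite: Schoof2009, Corollary 6.5 (i)] -/
theorem cassels_padic {p q : ℕ} (hp : p.Prime) (hq : q.Prime) (hpo : Odd p) (hqo : Odd q)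
    {x y : ℤ} (hx : x ≠ 0) (hy : y ≠ 0) (h : x ^ p - y ^ q = 1) :
    ∃ a v : ℤ, x - 1 = p ^ (q - 1) * a ^ q ∧ (∑ i ∈ range p, x ^ i) = p * v ^ q ∧
      y = p * a * v ∧ ¬ (p : ℤ) ∣ v ∧ 0 < v := by
  obtain ⟨-, hpy⟩ := cassels hp hq hpo hqo hx hy h
  have h' : y ^ q = x ^ p - 1 ^ p := by rw [one_pow]; linarith
  obtain ⟨a, v, h1, h2, h3, h4⟩ := descent hp hpo hqo (Or.inl rfl) hpy h'
  simp only [one_pow, mul_one] at h2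
  refine ⟨a, v, h1, h2, h3, h4, ?_⟩
  -- `v > 0`: the cofactor `∑ x^i = (x^p - 1)/(x - 1)` is positive
  have hS : (∑ i ∈ range p, x ^ i) * (x - 1) = x ^ p - 1 := geom_sum_mul x p
  have hSpos : 0 < ∑ i ∈ range p, x ^ i := by
    rcases lt_trichotomy x 1 with hlt | rfl | hgt
    · have hx0 : x < 0 := lt_of_le_of_ne (by omega) hx
      have : x ^ p - 1 < 0 := by linarith [hpo.pow_neg hx0]
      exact pos_of_mul_neg_left (by rw [hS]; exact this) (by omega)
    · exfalso
      rw [one_pow] at h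
      exact hy (pow_eq_zero_iff hq.ne_zero |>.mp (by linarith))
    · have : 0 < x ^ p - 1 := by linarith [one_lt_pow₀ hgt hp.ne_zero]
      exact pos_of_mul_pos_left (by rw [hS]; exact this) (by omega)
  rw [h2] at hSpos
  have : 0 < v ^ q := pos_of_mul_pos_right hSpos (by positivity)
  exact hqo.pow_pos_iff.mp this

/-- **[Schoof2009, Corollary 6.5 (ii)]** (`q`-adic information). For odd primes `p, q` and
non-zero integers with `x ^ p - y ^ q = 1` there are integers `b, u` with
`y + 1 = q ^ (p-1) b ^ p`, `(y ^ q + 1)/(y + 1) = q u ^ p` and `x = q b u`; moreover `q ∤ u` and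
`u > 0`. (Cassels' theorem gives `q ∣ x`; then the descent lemma with `c = -1`.)
[cite: Schoof2009, Corollary 6.5 (ii)] -/
theorem cassels_qadic {p q : ℕ} (hp : p.Prime) (hq : q.Prime) (hpo : Odd p) (hqo : Odd q)
    {x y : ℤ} (hx : x ≠ 0) (hy : y ≠ 0) (h : x ^ p - y ^ q = 1) :
    ∃ b u : ℤ, y + 1 = q ^ (p - 1) * b ^ p ∧
      (∑ i ∈ range q, y ^ i * (-1) ^ (q - 1 - i)) = q * u ^ p ∧
      x = q * b * u ∧ ¬ (q : ℤ) ∣ u ∧ 0 < u := by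
  obtain ⟨hqx, -⟩ := cassels hp hq hpo hqo hx hy h
  have h' : x ^ p = y ^ q - (-1) ^ q := by rw [hqo.neg_one_pow]; linarith
  obtain ⟨b, u, h1, h2, h3, h4⟩ := descent hq hqo hpo (Or.inr rfl) hqx h'
  rw [sub_neg_eq_add] at h1
  refine ⟨b, u, h1, h2, h3, h4, ?_⟩
  -- `u > 0`: the cofactor `(y^q + 1)/(y + 1)` is positive
  have hTy : (∑ i ∈ range q, y ^ i * (-1) ^ (q - 1 - i)) * (y + 1) = y ^ q + 1 :=
    geom_sum₂_neg_one_mul hqo y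
  have hy1 : y + 1 ≠ 0 := by
    intro h0
    have : y = -1 := by linarith
    rw [this, hqo.neg_one_pow] at h
    exact hx (pow_eq_zero_iff hp.ne_zero |>.mp (by linarith))
  have hTpos : 0 < ∑ i ∈ range q, y ^ i * (-1) ^ (q - 1 - i) := by
    rcases lt_or_gt_of_ne hy1 with hneg | hpos
    · have hyq : y ^ q + 1 < 0 := by
        have h2' : 2 ≤ -y := by omega
        have : (2 : ℤ) ^ q ≤ (-y) ^ q := pow_le_pow_left₀ (by norm_num) h2' q
        rw [hqo.neg_pow] at this
        have : (2 : ℤ) ≤ 2 ^ q := by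
          calc (2 : ℤ) = 2 ^ 1 := by norm_num
            _ ≤ 2 ^ q := pow_le_pow_right₀ (by norm_num) hq.one_lt.le
        linarith
      exact pos_of_mul_neg_left (by rw [hTy]; exact hyq) hneg.le
    · have hyq : 0 < y ^ q + 1 := by
        have : 0 ≤ y ^ q := pow_nonneg (by omega) q
        linarith
      exact pos_of_mul_pos_left (by rw [hTy]; exact hyq) hpos.le
  rw [h2] at hTpos
  have : 0 < u ^ p := pos_of_mul_pos_right hTpos (by positivity)
  exact hpo.pow_pos_iff.mp this

/-- **[Schoof2009, Corollary 6.5 (iii)]** (Archimedean information), in the directly proved form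
`|x| ≥ p ^ (q-1) - 1` and `|y| ≥ q ^ (p-1) - 1` (from (i): `a ≠ 0`, and (ii): `b ≠ 0`). The
printed statement is `|x| ≥ max (p^(q-1) - 1, q^(p-1) + q)` and symmetrically for `y`; its second
entry is `Catalan.abs_ge_of_pow_sub_pow_eq_one` when `p > q`, while for `p < q` Schoof invokes the
comparison `q^(p-1) - 1 > p^(q-1) + p` (Exercise 6.3), which is not formalised here.
[cite: Schoof2009, Corollary 6.5 (iii)] -/
theorem cassels_archimedean {p q : ℕ} (hp : p.Prime) (hq : q.Prime) (hpo : Odd p) (hqo : Odd q)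
    {x y : ℤ} (hx : x ≠ 0) (hy : y ≠ 0) (h : x ^ p - y ^ q = 1) :
    (p : ℤ) ^ (q - 1) - 1 ≤ |x| ∧ (q : ℤ) ^ (p - 1) - 1 ≤ |y| := by
  constructor
  · obtain ⟨a, v, h1, -, -, -, -⟩ := cassels_padic hp hq hpo hqo hx hy h
    have ha : a ≠ 0 := by
      rintro rfl
      rw [zero_pow hq.ne_zero, mul_zero, sub_eq_zero] at h1
      rw [h1, one_pow] at h
      exact hy (pow_eq_zero_iff hq.ne_zero |>.mp (by linarith))
    have h2 : (p : ℤ) ^ (q - 1) ≤ |x - 1| := by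
      rw [h1, abs_mul, abs_pow, abs_pow, Nat.abs_cast]
      calc (p : ℤ) ^ (q - 1) = (p : ℤ) ^ (q - 1) * 1 := (mul_one _).symm
        _ ≤ (p : ℤ) ^ (q - 1) * |a| ^ q :=
            mul_le_mul_of_nonneg_left (one_le_pow₀ (Int.one_le_abs ha)) (by positivity)
    have h3 : |x - 1| ≤ |x| + 1 := by
      calc |x - 1| ≤ |x| + |1| := abs_sub _ _
        _ = |x| + 1 := by rw [abs_one]
    linarith
  · obtain ⟨b, u, h1, -, -, -, -⟩ := cassels_qadic hp hq hpo hqo hx hy h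
    have hb : b ≠ 0 := by
      rintro rfl
      rw [zero_pow hp.ne_zero, mul_zero] at h1
      have : y = -1 := by linarith
      rw [this, hqo.neg_one_pow] at h
      exact hx (pow_eq_zero_iff hp.ne_zero |>.mp (by linarith))
    have h2 : (q : ℤ) ^ (p - 1) ≤ |y + 1| := by
      rw [h1, abs_mul, abs_pow, abs_pow, Nat.abs_cast]
      calc (q : ℤ) ^ (p - 1) = (q : ℤ) ^ (p - 1) * 1 := (mul_one _).symm
        _ ≤ (q : ℤ) ^ (p - 1) * |b| ^ p :=
            mul_le_mul_of_nonneg_left (one_le_pow₀ (Int.one_le_abs hb)) (by positivity)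
    have h3 : |y + 1| ≤ |y| + 1 := by
      calc |y + 1| ≤ |y| + |1| := abs_add_le _ _
        _ = |y| + 1 := by rw [abs_one]
    linarith

end Catalan

end Literature.NumberTheory.DiophantineGeometry
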